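import Summits.NavierStokesRegularity.NavierStokesRegularity.Theorems.LevelSetModerationHighSpeedPressureWorkOccupationQuantum
import Summits.NavierStokesRegularity.NavierStokesRegularity.Theorems.LevelSetModerationHighSpeedPressureWorkCostCauchySchwarz
import Summits.NavierStokesRegularity.NavierStokesRegularity.Theorems.LevelSetModerationHighSpeedPressureWorkCruxStructure

/-!
# Route LevelSetModeration — `HighSpeedPressureWork`: late viscous bookkeeping under a speed bound

Support file for item stmt-NavierStokesRegularity-18149 (line `iso-speed-area-closure`); proves the
registered stub `stub_lateViscousBookkeeping` (L3-LW). Notation `s = |u|`, `A = {s > c}`, `a = |A|`,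
`d = ∫_A ‖∇s‖²`, `V = ∫₀ᵀ a`, `D = ∫₀ᵀ d`. Under a class-uniform speed bound the late part
(`τ ≥ tₑν/B₀² > ν/G'²`, the smoothing delay) of `ν ∫∫_A [(c/s)‖∇s‖² + (1 − c/s)|∇u|²_F]` is
`≤ √(F V) √D`: there `‖∇u‖ ≤ L = C_g G'²/ν` (`exists_norm_fderiv_le_of_speed_le_delay`), so
`d ≤ L² a`, `(1 − c/s)|∇u|²_F ≤ 3L²(s − c)/c` on `A`, and the slice Sobolev bound
`∫_A (s − c) ≤ K a^{5/6} d^{1/2}` (`δ`-regularised truncation `√(δ² + (s−c)₊²) − δ ∈ C¹`, `H¹ ⊂ L⁶`,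
Hölder on `A`, `δ → 0`) with Chebyshev `a ≤ E₀/c²` bounds each late slice by
`(L + (3L²K/c)(E₀/c²)^{1/3}) a^{1/2} d^{1/2}`; Cauchy–Schwarz in time concludes.
-/

noncomputable section

-- single-conjunct summit: `Summit.<Summit>.<Problem>` repeats the name by the D-0017 layout
set_option linter.dupNamespace false

namespace Summit.NavierStokesRegularity.NavierStokesRegularity.Theorems

open MeasureTheory Set Filter Topology Function
open scoped ENNReal NNReal
open Literature.Analysis.FluidPDE

open Summit.NavierStokesRegularity.NavierStokesRegularity.Theorems.LevelSetEnergyInequality in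
/-- **`δ`-regularised truncation of the speed.** For a `C¹` field `v`, `c > 0`, `δ > 0`, the scalar
`w = √(δ² + (|v| − c)₊²) − δ` is `C¹`, `0 ≤ w ≤ (|v| − c)₊ ≤ w + δ`, `|∇w| ≤ 1_{|v|>c} |∇|v||`.
[folklore] -/
theorem lateViscous_exists_truncation (v : EuclideanSpace ℝ (Fin 3) → EuclideanSpace ℝ (Fin 3))
    {c δ : ℝ} (hv : ContDiff ℝ 1 v) (hc : 0 < c) (hδ : 0 < δ) :
    ∃ w : EuclideanSpace ℝ (Fin 3) → ℝ, ContDiff ℝ 1 w ∧ (∀ x, 0 ≤ w x) ∧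
      (∀ x, w x ≤ max (‖v x‖ - c) 0) ∧ (∀ x, max (‖v x‖ - c) 0 ≤ w x + δ) ∧
      (∀ x, ‖fderiv ℝ w x‖ ≤
        Set.indicator {x | c < ‖v x‖} (fun x => ‖fderiv ℝ (fun y => ‖v y‖) x‖) x) := by
  set Ψ : EuclideanSpace ℝ (Fin 3) → ℝ := fun y => (max (‖v y‖ - c) 0) ^ 2 with hΨ
  have hF : ∀ y, 0 < δ ^ 2 + Ψ y := fun y => by positivity
  have ha0 : ∀ y, 0 ≤ max (‖v y‖ - c) 0 := fun y => le_max_right _ _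
  -- `a, δ ≤ √(δ² + a²) ≤ a + δ` for `a = (|v| − c)₊`
  have hup : ∀ y, Real.sqrt (δ ^ 2 + Ψ y) ≤ max (‖v y‖ - c) 0 + δ := fun y => by
    rw [Real.sqrt_le_left (by positivity), hΨ]
    nlinarith [ha0 y]
  have hdn : ∀ y, max (‖v y‖ - c) 0 ≤ Real.sqrt (δ ^ 2 + Ψ y) := fun y =>
    calc max (‖v y‖ - c) 0 = Real.sqrt (Ψ y) := (Real.sqrt_sq (ha0 y)).symm
      _ ≤ Real.sqrt (δ ^ 2 + Ψ y) := Real.sqrt_le_sqrt (by nlinarith)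
  have hlow : ∀ y, δ ≤ Real.sqrt (δ ^ 2 + Ψ y) := fun y => (Real.sqrt_sq hδ.le).symm.trans_le
    (Real.sqrt_le_sqrt (by nlinarith [sq_nonneg (max (‖v y‖ - c) 0)]))
  refine ⟨fun y => Real.sqrt (δ ^ 2 + Ψ y) - δ, ?_, fun y => sub_nonneg.2 (hlow y),
    fun y => sub_le_iff_le_add.2 (hup y), fun y => (hdn y).trans_eq (sub_add_cancel _ δ).symm,
    fun y => ?_⟩
  · exact ((contDiff_const.add ((contDiff_one_truncSq hc).comp hv)).sqrt
      fun y => (hF y).ne').sub contDiff_const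
  · have hF' : HasFDerivAt (fun z => δ ^ 2 + Ψ z)
        ((2 * max (‖v y‖ - c) 0) • fderiv ℝ (fun z => ‖v z‖) y) y :=
      (fderiv_truncSq_comp hv hc y).const_add (δ ^ 2)
    rw [((hF'.sqrt (hF y).ne').sub_const δ).fderiv, smul_smul, norm_smul, Real.norm_eq_abs]
    set a := max (‖v y‖ - c) 0 with ha
    have hsqrt_pos : 0 < Real.sqrt (δ ^ 2 + Ψ y) := Real.sqrt_pos.2 (hF y)
    have hcoef : |1 / (2 * Real.sqrt (δ ^ 2 + Ψ y)) * (2 * a)| = a / Real.sqrt (δ ^ 2 + Ψ y) := by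
      rw [abs_of_nonneg (by positivity)]
      field_simp
    rw [hcoef]
    by_cases hyc : c < ‖v y‖
    · rw [indicator_of_mem (show y ∈ {x | c < ‖v x‖} from hyc)]
      have hle1 : a / Real.sqrt (δ ^ 2 + Ψ y) ≤ 1 := by
        rw [div_le_one hsqrt_pos]
        exact hdn y
      simpa using mul_le_mul_of_nonneg_right hle1 (norm_nonneg (fderiv ℝ (fun z => ‖v z‖) y))
    · rw [indicator_of_notMem (show y ∉ {x | c < ‖v x‖} from hyc)]
      have : a = 0 := by rw [ha]; exact max_eq_right (by linarith [not_lt.1 hyc])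
      rw [this, zero_div, zero_mul]

/-- **The late slice bound.** For a `C¹` square-integrable field `v` on `ℝ³`, a level `c > 0` with
`a = |{|v|>c}| < ∞` and a gradient bound `‖∇v‖ ≤ L` on `{|v| > c}`:
`∫ 1_{|v|>c} [(c/|v|)‖∇|v|‖² + (1 − c/|v|)|∇v|²_F] ≤ (L + (3L²/c) K a^{1/3}) a^{1/2} d^{1/2}`,
`d = ∫ 1_{|v|>c} ‖∇|v|‖²`, `K = SNormLESNormFDerivOfEqConst ℝ volume 2`: `c/|v| ≤ 1` and
`d ≤ L² a`; `|∇v|²_F ≤ 3L²`, `1 − c/|v| ≤ (|v| − c)/c`, and the slice Sobolev bound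
`∫_{|v|>c} (|v| − c) ≤ K a^{5/6} d^{1/2}` (Hölder `L¹ ⊂ L⁶` on the super-level set and the
whole-space Gagliardo–Nirenberg–Sobolev inequality for the `δ`-regularised truncations, `δ → 0`).
[folklore] -/
theorem lateViscous_slice_le
    (v : EuclideanSpace ℝ (Fin 3) → EuclideanSpace ℝ (Fin 3)) {c L : ℝ} (hv : ContDiff ℝ 1 v)
    (hv2 : MemLp v 2 volume) (hc : 0 < c) (hA : volume {x | c < ‖v x‖} ≠ ∞) (hL0 : 0 ≤ L)
    (hL : ∀ x, c < ‖v x‖ → ‖fderiv ℝ v x‖ ≤ L) :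
    (∫⁻ x, {x | c < ‖v x‖}.indicator (fun x => ENNReal.ofReal
        (c / ‖v x‖ * ‖fderiv ℝ (fun y => ‖v y‖) x‖ ^ 2 +
          (1 - c / ‖v x‖) * frobeniusNormSq (fderiv ℝ v x))) x) ≤
      (ENNReal.ofReal L + ENNReal.ofReal (3 * L ^ 2 / c) *
          (SNormLESNormFDerivOfEqConst ℝ (volume : Measure (EuclideanSpace ℝ (Fin 3))) 2 : ℝ≥0∞) *
          volume {x | c < ‖v x‖} ^ (1 / 3 : ℝ)) *
        (volume {x | c < ‖v x‖} ^ (1 / 2 : ℝ) * (∫⁻ x, {x | c < ‖v x‖}.indicator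
          (fun x => ENNReal.ofReal (‖fderiv ℝ (fun y => ‖v y‖) x‖ ^ 2)) x) ^ (1 / 2 : ℝ)) := by
  set A : Set (EuclideanSpace ℝ (Fin 3)) := {x | c < ‖v x‖} with hAdef
  have hA_meas : MeasurableSet A := (isOpen_lt continuous_const hv.continuous.norm).measurableSet
  set Kc : ℝ≥0 := SNormLESNormFDerivOfEqConst ℝ (volume : Measure (EuclideanSpace ℝ (Fin 3))) 2
  set f₁ : EuclideanSpace ℝ (Fin 3) → ℝ≥0∞ := A.indicator
      (fun x => ENNReal.ofReal (‖fderiv ℝ (fun y => ‖v y‖) x‖ ^ 2)) with hf₁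
  set d : ℝ≥0∞ := ∫⁻ x, f₁ x with hd
  set f₂ : EuclideanSpace ℝ (Fin 3) → ℝ≥0∞ := A.indicator
      (fun x => ENNReal.ofReal (‖v x‖ - c)) with hf₂
  have hf₁m : Measurable f₁ :=
    ((measurable_fderiv ℝ (fun y => ‖v y‖)).norm.pow_const 2).ennreal_ofReal.indicator hA_meas
  -- (i) the slice Sobolev bound `∫ f₂ ≤ K a^{5/6} d^{1/2}`
  have hsub : ∫⁻ x, f₂ x ≤ (Kc : ℝ≥0∞) * (volume A ^ (1 / 3 : ℝ) * volume A ^ (1 / 2 : ℝ)) *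
      d ^ (1 / 2 : ℝ) := by
    rw [hf₂, lintegral_indicator hA_meas, ← ENNReal.rpow_add_of_nonneg _ _ (by norm_num)
      (by norm_num), show (1 / 3 + 1 / 2 : ℝ) = 5 / 6 by norm_num]
    refine ENNReal.le_of_forall_pos_le_add fun ε hε _ => ?_
    obtain ⟨δ, hδpos, hδA⟩ := ENNReal.exists_nnreal_pos_mul_lt hA (ENNReal.coe_ne_zero.2 hε.ne')
    obtain ⟨w, hwC1, hw0, hwle, hwge, hwgrad⟩ :=
      lateViscous_exists_truncation v hv hc (NNReal.coe_pos.2 hδpos)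
    have hw_meas : AEStronglyMeasurable w volume := hwC1.continuous.aestronglyMeasurable
    have hw2 : eLpNorm w 2 volume < ∞ := by
      refine (eLpNorm_mono fun x => ?_).trans_lt hv2.eLpNorm_lt_top
      rw [Real.norm_eq_abs, abs_of_nonneg (hw0 x)]
      exact (hwle x).trans (max_le (by linarith) (norm_nonneg _))
    have hGNS := eLpNorm_six_le_eLpNorm_fderiv_two volume finrank_euclideanSpace_fin hwC1 hw2
    have hDw : eLpNorm (fderiv ℝ w) 2 volume ≤ d ^ (1 / 2 : ℝ) := by
      rw [eLpNorm_eq_lintegral_rpow_enorm_toReal two_ne_zero ENNReal.ofNat_ne_top,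
        ENNReal.toReal_ofNat]
      refine ENNReal.rpow_le_rpow (lintegral_mono fun x => ?_) (by norm_num)
      have h1 := hwgrad x
      rw [← ofReal_norm, ENNReal.ofReal_rpow_of_nonneg (norm_nonneg _) (by norm_num),
        Real.rpow_two]
      by_cases hx : x ∈ A
      · rw [indicator_of_mem hx] at h1
        rw [hf₁, indicator_of_mem hx]
        exact ENNReal.ofReal_le_ofReal (pow_le_pow_left₀ (norm_nonneg _) h1 2)
      · rw [indicator_of_notMem hx] at h1
        simp [hf₁, indicator_of_notMem hx, le_antisymm h1 (norm_nonneg _)]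
    have hH : ∫⁻ x in A, ‖w x‖ₑ ≤ eLpNorm w 6 volume * volume A ^ (5 / 6 : ℝ) := by
      have h1 := eLpNorm_le_eLpNorm_mul_rpow_measure_univ (μ := volume.restrict A) (p := 1)
        (q := 6) (f := w) (by norm_num) hw_meas.restrict
      rw [eLpNorm_one_eq_lintegral_enorm, Measure.restrict_apply_univ, ENNReal.toReal_one,
        ENNReal.toReal_ofNat, show (1 / 1 - 1 / 6 : ℝ) = 5 / 6 by norm_num] at h1
      refine h1.trans ?_
      gcongr
      exact Measure.restrict_le_self
    calc ∫⁻ x in A, ENNReal.ofReal (‖v x‖ - c)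
        ≤ ∫⁻ x in A, (‖w x‖ₑ + δ) := by
          refine lintegral_mono fun x => ?_
          rw [Real.enorm_eq_ofReal (hw0 x), ← ENNReal.ofReal_coe_nnreal,
            ← ENNReal.ofReal_add (hw0 x) δ.coe_nonneg]
          exact ENNReal.ofReal_le_ofReal ((le_max_left _ _).trans (hwge x))
      _ = (∫⁻ x in A, ‖w x‖ₑ) + δ * volume A := by
          rw [lintegral_add_right _ measurable_const, lintegral_const, Measure.restrict_apply_univ]
      _ ≤ eLpNorm w 6 volume * volume A ^ (5 / 6 : ℝ) + ε := add_le_add hH hδA.le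
      _ ≤ (Kc : ℝ≥0∞) * d ^ (1 / 2 : ℝ) * volume A ^ (5 / 6 : ℝ) + ε := by
          gcongr
          exact hGNS.trans (by gcongr)
      _ = (Kc : ℝ≥0∞) * volume A ^ (5 / 6 : ℝ) * d ^ (1 / 2 : ℝ) + ε := by ring
  -- (ii) pointwise bound of the integrand by `f₁ + (3L²/c) f₂`
  have hpt : ∀ x, A.indicator (fun x => ENNReal.ofReal
      (c / ‖v x‖ * ‖fderiv ℝ (fun y => ‖v y‖) x‖ ^ 2 +
        (1 - c / ‖v x‖) * frobeniusNormSq (fderiv ℝ v x))) x ≤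
      f₁ x + ENNReal.ofReal (3 * L ^ 2 / c) * f₂ x := by
    intro x
    by_cases hx : x ∈ A
    · rw [indicator_of_mem hx, hf₁, hf₂, indicator_of_mem hx, indicator_of_mem hx]
      have hcs : c < ‖v x‖ := hx
      have hs0 : 0 < ‖v x‖ := hc.trans hcs
      set g : ℝ := ‖fderiv ℝ (fun y => ‖v y‖) x‖ with hg
      have h1 : c / ‖v x‖ * g ^ 2 ≤ g ^ 2 :=
        mul_le_of_le_one_left (sq_nonneg g) ((div_le_one hs0).2 hcs.le)
      have h21 : 1 - c / ‖v x‖ ≤ (‖v x‖ - c) / c := by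
        rw [show 1 - c / ‖v x‖ = (‖v x‖ - c) / ‖v x‖ by field_simp]
        exact div_le_div_of_nonneg_left (sub_nonneg.2 hcs.le) hc hcs.le
      have h22 : frobeniusNormSq (fderiv ℝ v x) ≤ 3 * L ^ 2 :=
        (frobeniusNormSq_le_three_mul _).trans (by gcongr; exact hL x hcs)
      have h2 : (1 - c / ‖v x‖) * frobeniusNormSq (fderiv ℝ v x) ≤
          (‖v x‖ - c) / c * (3 * L ^ 2) :=
        mul_le_mul h21 h22 (frobeniusNormSq_nonneg _) (div_nonneg (sub_nonneg.2 hcs.le) hc.le)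
      have h3 : 0 ≤ ‖v x‖ - c := sub_nonneg.2 hcs.le
      rw [← ENNReal.ofReal_mul (by positivity), ← ENNReal.ofReal_add (sq_nonneg _) (by positivity)]
      refine ENNReal.ofReal_le_ofReal ?_
      calc c / ‖v x‖ * g ^ 2 + (1 - c / ‖v x‖) * frobeniusNormSq (fderiv ℝ v x)
          ≤ g ^ 2 + (‖v x‖ - c) / c * (3 * L ^ 2) := add_le_add h1 h2
        _ = g ^ 2 + 3 * L ^ 2 / c * (‖v x‖ - c) := by ring
    · rw [indicator_of_notMem hx]
      exact bot_le
  -- (iii) `d ≤ L² a`, so `d ≤ L a^{1/2} d^{1/2}`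
  have hdle : d ≤ ENNReal.ofReal L * (volume A ^ (1 / 2 : ℝ) * d ^ (1 / 2 : ℝ)) := by
    have h1 : d ≤ ENNReal.ofReal (L ^ 2) * volume A := by
      rw [← lintegral_indicator_const hA_meas]
      refine lintegral_mono fun x => ?_
      by_cases hx : x ∈ A
      · rw [hf₁, indicator_of_mem hx, indicator_of_mem hx]
        exact ENNReal.ofReal_le_ofReal (pow_le_pow_left₀ (norm_nonneg _)
          ((norm_fderiv_norm_comp_le (hv.differentiable one_ne_zero x)
            (norm_pos_iff.1 (hc.trans hx))).trans (hL x hx)) 2)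
      · rw [hf₁, indicator_of_notMem hx, indicator_of_notMem hx]
    calc d = d ^ (1 / 2 : ℝ) * d ^ (1 / 2 : ℝ) := by
          rw [← ENNReal.rpow_add_of_nonneg _ _ (by norm_num) (by norm_num)]; norm_num
      _ ≤ (ENNReal.ofReal (L ^ 2) * volume A) ^ (1 / 2 : ℝ) * d ^ (1 / 2 : ℝ) :=
          mul_le_mul' (ENNReal.rpow_le_rpow h1 (by norm_num)) le_rfl
      _ = _ := by
          rw [ENNReal.mul_rpow_of_nonneg _ _ (by norm_num : (0 : ℝ) ≤ 1 / 2),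
            ENNReal.ofReal_rpow_of_nonneg (sq_nonneg _) (by norm_num), ← Real.sqrt_eq_rpow,
            Real.sqrt_sq hL0, mul_assoc]
  refine (lintegral_mono hpt).trans ?_
  rw [lintegral_add_left hf₁m, lintegral_const_mul' _ _ ENNReal.ofReal_ne_top]
  exact (add_le_add hdle (mul_le_mul' le_rfl hsub)).trans_eq (by ring)

/-- **Late viscous bookkeeping under a speed bound** (registered stub `stub_lateViscousBookkeeping`,
L3-LW of line `iso-speed-area-closure`, item stmt-NavierStokesRegularity-18149): on a fibre `(ν, T)`
with a class-uniform speed bound `G(E₀,B₀)` and for every window constant `tₑ > 0` some modulus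
`F` makes the full level-set dissipation integrand finite on `(0,T) × ℝ³` with late part
`ν ∫_{tₑν/B₀²}^{t}∫ 1_{|u|>c}[(c/|u|)‖∇|u|‖² + (1−c/|u|)|∇u|²_F] ≤ √(F V_c(T)) √(D_c(T))`
(`F = ν²(L + 3L²K(E₀⁺/B₀²)^{1/3}/B₀)²`, `L = C_g G'²/ν`, `G' = max(G, 2B₀/√tₑ)`). [folklore] -/
theorem stub_lateViscousBookkeeping :
    ∀ (ν T : ℝ), 0 < ν → 0 < T → ∀ G : ℝ → ℝ → ℝ, (∀ (u : ℝ → EuclideanSpace ℝ (Fin 3) → EuclideanSpace ℝ (Fin 3)) (p : ℝ → EuclideanSpace ℝ (Fin 3) → ℝ), Literature.Analysis.FluidPDE.IsClassicalNSSolutionOn (Set.Ico 0 T) ν 0 u p → Literature.Analysis.FluidPDE.IsLerayHopfOn T ν 0 (u 0) u → Literature.Analysis.FluidPDE.HasRapidSpatialDecay (u 0) → ∀ (E₀ B₀ : ℝ), (∫ x, ‖u 0 x‖ ^ 2) ≤ E₀ → (∀ x, ‖u 0 x‖ ≤ B₀) → ∀ t ∈ Set.Ico 0 T, ∀ x, ‖u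 t x‖ ≤ G E₀ B₀) → ∀ tₑ : ℝ, 0 < tₑ → ∃ F : ℝ → ℝ → ℝ, ∀ (u : ℝ → EuclideanSpace ℝ (Fin 3) → EuclideanSpace ℝ (Fin 3)) (p : ℝ → EuclideanSpace ℝ (Fin 3) → ℝ), Literature.Analysis.FluidPDE.IsClassicalNSSolutionOn (Set.Ico 0 T) ν 0 u p → Literature.Analysis.FluidPDE.IsLerayHopfOn T ν 0 (u 0) u → Literature.Analysis.FluidPDE.HasRapidSpatialDecay (u 0) → ∀ (E₀ B₀ : ℝ), (∫ x, ‖u 0 x‖ ^ 2) ≤ E₀ → (∀ x, ‖u 0 x‖ ≤ B₀) → ∀ (M c t : ℝ), 2 * B₀ ≤ M → M / 2 ≤ c → c ≤ M → 0 < c → t ∈ Set.Ico 0 T → tₑ * ν / B₀ ^ 2 ≤ t → (∫⁻ τ in Set.Ioo 0 T, ∫⁻ x, Set.indicator {x | c < ‖u τ x‖} (fun x => ENNReal.ofReal (c / ‖u τ x‖ * ‖fderiv ℝ (fun y => ‖u τ y‖) x‖ ^ 2 + (1 - c / ‖u τ x‖) * Literature.Analysis.FluidPDE.frobeniusNormSq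 (fderiv ℝ (u τ) x))) x) ≠ ⊤ ∧ ν * (∫⁻ τ in Set.Ioo (tₑ * ν / B₀ ^ 2) t, ∫⁻ x, Set.indicator {x | c < ‖u τ x‖} (fun x => ENNReal.ofReal (c / ‖u τ x‖ * ‖fderiv ℝ (fun y => ‖u τ y‖) x‖ ^ 2 + (1 - c / ‖u τ x‖) * Literature.Analysis.FluidPDE.frobeniusNormSq (fderiv ℝ (u τ) x))) x).toReal ≤ Real.sqrt (F E₀ B₀ * (∫⁻ τ in Set.Ioo 0 T, volume {x | c < ‖u τ x‖}).toReal) * Real.sqrt ((∫⁻ τ in Set.Ioo 0 T, ∫⁻ x, Set.indicator {x | c < ‖u τ x‖} (fun x => ENNReal.ofReal (‖fderiv ℝ (fun y => ‖u τ y‖) x‖ ^ 2)) x).toReal) := by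
  intro ν T hν hT G hG tₑ htₑ
  -- the smoothing constant (delay `1`), the Sobolev constant, the modulus `F`
  obtain ⟨Cg, hCg⟩ := exists_norm_fderiv_le_of_speed_le_delay (d := 1) one_pos
  set Cg' : ℝ := max Cg 1 with hCg'
  have hCg'0 : 0 < Cg' := lt_of_lt_of_le one_pos (le_max_right _ _)
  set Kc : ℝ≥0 := SNormLESNormFDerivOfEqConst ℝ (volume : Measure (EuclideanSpace ℝ (Fin 3))) 2
  refine ⟨fun E₀ B₀ => (ν * (Cg' * (max (G E₀ B₀) (2 * B₀ / Real.sqrt tₑ)) ^ 2 / ν +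
    3 * (Cg' * (max (G E₀ B₀) (2 * B₀ / Real.sqrt tₑ)) ^ 2 / ν) ^ 2 * (Kc : ℝ) *
      ((max E₀ 0 / B₀ ^ 2) ^ (1 / 3 : ℝ) / B₀))) ^ 2, ?_⟩
  intro u p hcl hLH hdec E₀ B₀ hE₀ hB₀ M c t hM hMc hcM hc ht ht₁
  dsimp only
  set G₀ : ℝ := max (G E₀ B₀) (2 * B₀ / Real.sqrt tₑ) with hG₀def
  set L₀ : ℝ := Cg' * G₀ ^ 2 / ν with hL₀def
  set Λf : ℝ := 3 * L₀ ^ 2 * (Kc : ℝ) * ((max E₀ 0 / B₀ ^ 2) ^ (1 / 3 : ℝ) / B₀) with hΛfdef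
  set t₁ : ℝ := tₑ * ν / B₀ ^ 2 with ht₁def
  -- the slices `a`, `d`, the full integrand slice, `V`, `D`
  set Vs : ℝ → ℝ≥0∞ := fun τ => volume {x | c < ‖u τ x‖} with hVs
  set Ds : ℝ → ℝ≥0∞ := fun τ => ∫⁻ x, {x | c < ‖u τ x‖}.indicator
      (fun x => ENNReal.ofReal (‖fderiv ℝ (fun y => ‖u τ y‖) x‖ ^ 2)) x with hDs
  set Ss : ℝ → ℝ≥0∞ := fun τ => ∫⁻ x, {x | c < ‖u τ x‖}.indicator (fun x => ENNReal.ofReal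
      (c / ‖u τ x‖ * ‖fderiv ℝ (fun y => ‖u τ y‖) x‖ ^ 2 +
        (1 - c / ‖u τ x‖) * frobeniusNormSq (fderiv ℝ (u τ) x))) x with hSs
  set V : ℝ≥0∞ := ∫⁻ τ in Ioo 0 T, Vs τ with hVdef
  set D : ℝ≥0∞ := ∫⁻ τ in Ioo 0 T, Ds τ with hDdef
  have hVfin : V ≠ ∞ := levelSetModeration_highSetMeasure_ne_top hν.le hLH hc
  have hDfin : D ≠ ∞ := (levelSetDissipation_ne_top hcl hLH hT hν.le hc.le).1
  have ht₁0 : 0 ≤ t₁ := div_nonneg (mul_pos htₑ hν).le (sq_nonneg _)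
  have hIsub : Ioo t₁ t ⊆ Ioo 0 T := Ioo_subset_Ioo ht₁0 ht.2.le
  have hIco : ∀ τ ∈ Ioo t₁ t, τ ∈ Ico 0 T := fun τ hτ => ⟨ht₁0.trans hτ.1.le, hτ.2.trans ht.2⟩
  -- (1) finiteness of the full integral: the integrand is at most `2 |∇u|²_F`
  have hfrob := IsLerayHopfOn.lintegral_frobeniusNormSq_fderiv_of_classical hcl hLH hT
  have hSs_le2 : ∀ τ ∈ Ico 0 T,
      Ss τ ≤ 2 * ∫⁻ x, ENNReal.ofReal (frobeniusNormSq (fderiv ℝ (u τ) x)) := by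
    intro τ hτ
    have hdiff : Differentiable ℝ (u τ) := (hcl.contDiff_velocity hτ).differentiable (by simp)
    rw [← lintegral_const_mul' _ _ ENNReal.ofNat_ne_top]
    refine lintegral_mono fun x => ?_
    by_cases hx : x ∈ {x | c < ‖u τ x‖}
    · rw [indicator_of_mem hx]
      have hcs : c < ‖u τ x‖ := hx
      have hs0 : 0 < ‖u τ x‖ := hc.trans hcs
      have hfr0 := frobeniusNormSq_nonneg (fderiv ℝ (u τ) x)
      have hg : ‖fderiv ℝ (fun y => ‖u τ y‖) x‖ ^ 2 ≤ frobeniusNormSq (fderiv ℝ (u τ) x) :=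
        (pow_le_pow_left₀ (norm_nonneg _)
          (norm_fderiv_norm_comp_le (hdiff x) (norm_pos_iff.1 hs0)) 2).trans
          (sq_opNorm_le_frobeniusNormSq _)
      have hcs1 : c / ‖u τ x‖ ≤ 1 := (div_le_one hs0).2 hcs.le
      refine (ENNReal.ofReal_le_ofReal
        (?_ : _ ≤ 2 * frobeniusNormSq (fderiv ℝ (u τ) x))).trans_eq ?_
      · nlinarith [mul_nonneg (by positivity : 0 ≤ c / ‖u τ x‖) (sub_nonneg.2 hg)]
      · rw [ENNReal.ofReal_mul zero_le_two, ENNReal.ofReal_ofNat]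
    · rw [indicator_of_notMem hx]
      exact bot_le
  have hfull_le : (∫⁻ τ in Ioo 0 T, Ss τ) ≤
      2 * ∫⁻ τ in Ioo 0 T, ∫⁻ x, ENNReal.ofReal (frobeniusNormSq (fderiv ℝ (u τ) x)) := by
    rw [← lintegral_const_mul' _ _ ENNReal.ofNat_ne_top]
    exact setLIntegral_mono' measurableSet_Ioo fun τ hτ => hSs_le2 τ (Ioo_subset_Ico_self hτ)
  refine ⟨ne_top_of_le_ne_top (ENNReal.mul_ne_top ENNReal.ofNat_ne_top hfrob.1) hfull_le, ?_⟩
  -- (2) the late bound; first the rest state `B₀ ≤ 0`: every level set above `c > 0` is empty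
  rcases le_or_gt B₀ 0 with hB₀0 | hB₀pos
  · have h0 : ∀ x, u 0 x = 0 := fun x => norm_le_zero_iff.1 ((hB₀ x).trans hB₀0)
    have hzero : (∫⁻ τ in Ioo t₁ t, Ss τ) = 0 := by
      refine le_antisymm ((setLIntegral_mono' (g := fun _ => 0) measurableSet_Ioo
        fun τ hτ => ?_).trans_eq lintegral_zero) bot_le
      have hu0 := levelSetModeration_eq_zero_of_datum_eq_zero hν hcl hLH h0 (hIco τ hτ)
      refine (lintegral_mono fun x => ?_).trans_eq lintegral_zero
      rw [indicator_of_notMem (by simp [hu0 x, hc.le])]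
    rw [hzero, ENNReal.toReal_zero, mul_zero]
    exact mul_nonneg (Real.sqrt_nonneg _) (Real.sqrt_nonneg _)
  -- data facts, the enlarged speed bound `G₀` on `[0, T']`, `T' = (t+T)/2`
  have hB₀c : B₀ ≤ c := by linarith
  set T' : ℝ := (t + T) / 2 with hT'def
  obtain ⟨hT'pos, hT'T, htT'⟩ : 0 < T' ∧ T' < T ∧ t < T' := by
    refine ⟨?_, ?_, ?_⟩ <;> · rw [hT'def]; linarith [ht.1, ht.2]
  have hst : 0 < Real.sqrt tₑ := Real.sqrt_pos.2 htₑ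
  have hG₀ge : 2 * B₀ / Real.sqrt tₑ ≤ G₀ := le_max_right _ _
  have hG₀pos : 0 < G₀ := lt_of_lt_of_le (by positivity) hG₀ge
  have hbd : ∀ s ∈ Icc 0 T', ∀ x, ‖u s x‖ ≤ G₀ := fun s hs x =>
    (hG u p hcl hLH hdec E₀ B₀ hE₀ hB₀ s ⟨hs.1, hs.2.trans_lt hT'T⟩ x).trans (le_max_left _ _)
  -- uniform `L²` bound of the slices
  set K : ℝ≥0∞ := (ENNReal.ofReal (∫ x, ‖u 0 x‖ ^ 2)) ^ (1 / 2 : ℝ) with hK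
  have hKtop : K ≠ ∞ := ENNReal.rpow_ne_top_of_nonneg (by norm_num) ENNReal.ofReal_ne_top
  have hL2 : ∀ s ∈ Icc 0 T', eLpNorm (u s) 2 volume ≤ K := by
    intro s hs
    have h := lintegral_enorm_sq_le_of_lerayHopf hLH hν.le ⟨hs.1, hs.2.trans hT'T.le⟩
    rw [eLpNorm_eq_lintegral_rpow_enorm_toReal (by norm_num) (by norm_num), ENNReal.toReal_ofNat,
      hK]
    refine ENNReal.rpow_le_rpow (le_trans (le_of_eq (lintegral_congr fun x => ?_)) h) (by norm_num)
    rw [ENNReal.rpow_two]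
  -- the delay `ν/G₀² ≤ t₁` and the gradient bound `‖∇u‖ ≤ L₀` on the late window
  have hdelay : 1 * ν / G₀ ^ 2 ≤ t₁ := by
    rw [one_mul, ht₁def, div_le_div_iff₀ (by positivity) (by positivity)]
    have h1 : 2 * B₀ ≤ G₀ * Real.sqrt tₑ := by rwa [div_le_iff₀ hst] at hG₀ge
    have h2 : (2 * B₀) ^ 2 ≤ (G₀ * Real.sqrt tₑ) ^ 2 := pow_le_pow_left₀ (by positivity) h1 2
    rw [mul_pow, mul_pow, Real.sq_sqrt htₑ.le] at h2
    nlinarith [mul_nonneg hν.le (sub_nonneg.2 h2), mul_nonneg hν.le (sq_nonneg B₀)]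
  have hL₀0 : 0 ≤ L₀ := by rw [hL₀def]; positivity
  have hgrad : ∀ τ ∈ Ioo t₁ t, ∀ x, ‖fderiv ℝ (u τ) x‖ ≤ L₀ := by
    intro τ hτ x
    refine (hCg hν hG₀pos hcl hT'pos hT'T hbd hKtop hL2 τ
      ⟨lt_of_le_of_lt hdelay hτ.1, hτ.2.trans htT'⟩ x).trans ?_
    rw [hL₀def]
    gcongr
    exact le_max_left _ _
  -- Chebyshev `a(τ) ≤ E₀⁺/c²` and the `c`-free constant `Λf ≥ (3L₀²/c) K (E₀⁺/c²)^{1/3}`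
  set Eₑ : ℝ≥0∞ := ENNReal.ofReal (max E₀ 0 / c ^ 2) with hEₑ
  have hVs_le : ∀ τ ∈ Ico 0 T, Vs τ ≤ Eₑ := by
    intro τ hτ
    refine (levelSetModeration_volume_superlevel_le hν.le hLH ⟨hτ.1, hτ.2.le⟩ hc).trans ?_
    rw [hEₑ, ENNReal.ofReal_div_of_pos (by positivity), VectorCalculus.kineticEnergy]
    gcongr
    linarith [le_max_left E₀ 0]
  have hΛf0 : 0 ≤ Λf := by rw [hΛfdef]; positivity
  have hΛle : ENNReal.ofReal (3 * L₀ ^ 2 / c) * (Kc : ℝ≥0∞) * Eₑ ^ (1 / 3 : ℝ) ≤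
      ENNReal.ofReal Λf := by
    rw [hEₑ, ENNReal.ofReal_rpow_of_nonneg (by positivity) (by norm_num),
      ← ENNReal.ofReal_coe_nnreal, ← ENNReal.ofReal_mul (by positivity),
      ← ENNReal.ofReal_mul (by positivity)]
    refine ENNReal.ofReal_le_ofReal ?_
    have h1 : (max E₀ 0 / c ^ 2) ^ (1 / 3 : ℝ) ≤ (max E₀ 0 / B₀ ^ 2) ^ (1 / 3 : ℝ) :=
      Real.rpow_le_rpow (by positivity) (div_le_div_of_nonneg_left (le_max_right _ _)
        (by positivity) (pow_le_pow_left₀ hB₀pos.le hB₀c 2)) (by norm_num)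
    calc 3 * L₀ ^ 2 / c * (Kc : ℝ) * (max E₀ 0 / c ^ 2) ^ (1 / 3 : ℝ)
        = 3 * L₀ ^ 2 * (Kc : ℝ) * ((max E₀ 0 / c ^ 2) ^ (1 / 3 : ℝ) / c) := by ring
      _ ≤ Λf := by rw [hΛfdef]; gcongr
  -- the slice bound on the late window
  have hslice : ∀ τ ∈ Ioo t₁ t, Ss τ ≤ (ENNReal.ofReal L₀ + ENNReal.ofReal Λf) *
      (Vs τ ^ (1 / 2 : ℝ) * Ds τ ^ (1 / 2 : ℝ)) := by
    intro τ hτ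
    have hτ' := hIco τ hτ
    have hVτ : Vs τ ≤ Eₑ := hVs_le τ hτ'
    refine (lateViscous_slice_le (u τ) ((hcl.contDiff_velocity hτ').of_le (mod_cast le_top))
      (hLH.memLp τ ⟨hτ'.1, hτ'.2.le⟩) hc (ne_top_of_le_ne_top ENNReal.ofReal_ne_top hVτ) hL₀0
      (fun x _ => hgrad τ hτ x)).trans ?_
    have h13 : ENNReal.ofReal (3 * L₀ ^ 2 / c) * (Kc : ℝ≥0∞) * Vs τ ^ (1 / 3 : ℝ) ≤
        ENNReal.ofReal Λf :=
      (mul_le_mul' le_rfl (ENNReal.rpow_le_rpow hVτ (by norm_num))).trans hΛle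
    gcongr
  -- integrate over the late window: measurability and Cauchy–Schwarz in time
  set μ' : Measure ℝ := volume.restrict (Ioo t₁ t) with hμ'
  have hμ'le : μ' ≤ volume.restrict (Ioo 0 t) :=
    Measure.restrict_mono (Ioo_subset_Ioo ht₁0 le_rfl) le_rfl
  have hVmeas : AEMeasurable Vs μ' := (levelSetModeration_aemeasurable_volume_superlevel
    hcl.smooth_velocity.continuousOn c ht.2.le).mono_measure hμ'le
  have hDmeas : AEMeasurable Ds μ' :=
    (levelSetModeration_aemeasurable_dissipationSlice hcl.smooth_velocity hc ht.2.le).mono_measure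
      hμ'le
  have hHolder : ∫⁻ τ, Vs τ ^ (1 / 2 : ℝ) * Ds τ ^ (1 / 2 : ℝ) ∂μ' ≤
      V ^ (1 / 2 : ℝ) * D ^ (1 / 2 : ℝ) := by
    have h := ENNReal.lintegral_mul_le_Lp_mul_Lq μ' Real.HolderConjugate.two_two
      (hVmeas.pow_const (1 / 2 : ℝ)) (hDmeas.pow_const (1 / 2 : ℝ))
    have hsq : ∀ z : ℝ≥0∞, (z ^ (1 / 2 : ℝ)) ^ (2 : ℝ) = z := fun z => by
      rw [← ENNReal.rpow_mul]; norm_num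
    simp only [Pi.mul_apply, hsq] at h
    exact h.trans (mul_le_mul' (ENNReal.rpow_le_rpow (lintegral_mono_set hIsub) (by norm_num))
      (ENNReal.rpow_le_rpow (lintegral_mono_set hIsub) (by norm_num)))
  have hlate : ∫⁻ τ, Ss τ ∂μ' ≤
      (ENNReal.ofReal L₀ + ENNReal.ofReal Λf) * (V ^ (1 / 2 : ℝ) * D ^ (1 / 2 : ℝ)) :=
    calc ∫⁻ τ, Ss τ ∂μ' ≤ ∫⁻ τ, (ENNReal.ofReal L₀ + ENNReal.ofReal Λf) *
          (Vs τ ^ (1 / 2 : ℝ) * Ds τ ^ (1 / 2 : ℝ)) ∂μ' := by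
          refine lintegral_mono_ae ?_
          filter_upwards [ae_restrict_mem measurableSet_Ioo] with τ hτ using hslice τ hτ
      _ ≤ (ENNReal.ofReal L₀ + ENNReal.ofReal Λf) * (V ^ (1 / 2 : ℝ) * D ^ (1 / 2 : ℝ)) := by
          rw [lintegral_const_mul' _ _
            (ENNReal.add_ne_top.2 ⟨ENNReal.ofReal_ne_top, ENNReal.ofReal_ne_top⟩)]
          exact mul_le_mul' le_rfl hHolder
  have hfin : (ENNReal.ofReal L₀ + ENNReal.ofReal Λf) * (V ^ (1 / 2 : ℝ) * D ^ (1 / 2 : ℝ)) ≠ ∞ :=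
    ENNReal.mul_ne_top (ENNReal.add_ne_top.2 ⟨ENNReal.ofReal_ne_top, ENNReal.ofReal_ne_top⟩)
      (ENNReal.mul_ne_top (ENNReal.rpow_ne_top_of_nonneg (by norm_num) hVfin)
        (ENNReal.rpow_ne_top_of_nonneg (by norm_num) hDfin))
  have hreal := ENNReal.toReal_mono hfin hlate
  rw [ENNReal.toReal_mul, ENNReal.toReal_mul, ENNReal.toReal_add ENNReal.ofReal_ne_top
    ENNReal.ofReal_ne_top, ENNReal.toReal_ofReal hL₀0, ENNReal.toReal_ofReal hΛf0,
    ← ENNReal.toReal_rpow, ← ENNReal.toReal_rpow, ← Real.sqrt_eq_rpow, ← Real.sqrt_eq_rpow]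
    at hreal
  calc ν * (∫⁻ τ, Ss τ ∂μ').toReal
      ≤ ν * ((L₀ + Λf) * (Real.sqrt V.toReal * Real.sqrt D.toReal)) :=
        mul_le_mul_of_nonneg_left hreal hν.le
    _ = Real.sqrt ((ν * (L₀ + Λf)) ^ 2 * V.toReal) * Real.sqrt D.toReal := by
        rw [Real.sqrt_mul (sq_nonneg _), Real.sqrt_sq (by positivity)]; ring

end Summit.NavierStokesRegularity.NavierStokesRegularity.Theorems

end
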